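import Summits.Parity.GeneralizedHardyLittlewood.Theses.DeterminantMoebiusCores

/-!
# Birth skeleton (BC3) for crux `HigherCores` — route DeterminantMoebiusCores, item stmt-Parity-15172

Line `birth` = the BOMBIERI–VINOGRADOV ARCHITECTURE of the crux, cut at its one classical joint.

`HigherCores` (rank 3, repaired rev 3, refuter-checked 2026-08-16) is a Bombieri–Vinogradov-type
statement for `k`-point `Λ♯`-cores (`k ≥ 3`): for every level `ν` with `ν + θ < 1/2`, the
divisor-weighted sum over moduli `q ≤ N^ν` of `|∑_{n ≡ r_q (q), u_q ≤ n ≤ v_q} ∏_{i<k} Λ♯(ψ_i(n))|` on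
TAME classes (whole shared part `gcd(ψ_i(r_q), q) ≤ N^{θ/2}` for every `i`) is `≤ N (log N)^{-A}`.
Every theorem of this shape in the tree and in print (Bombieri–Vinogradov itself,
`Literature.NumberTheory.Sieve.BombieriVinogradovStatement_holds`; Barban–Davenport–Halberstam;
Wolke / Siebert for multiplicative functions) is proved in TWO ranges of the modulus, by two
different mechanisms, and the line cuts the crux exactly there:

* `stub_siegelWalfiszRange` (S1 — the SIEGEL–WALFISZ RANGE, conjecture-grade, the HARDEST):
  the same weighted tame sum over the POLYLOGARITHMIC moduli `q ≤ (log N)^B`, for EVERY `B`, is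
  `≤ N (log N)^{-A}` for every `A`, uniformly over non-degenerate `k`-systems of size `≤ L`, all
  residues and all integer intervals `⊆ [-N, N]`; no level parameter (`θ < 1/2` only). This is the
  `k`-point analogue of the Siegel–Walfisz theorem (`siegel_walfisz_holds` is its `k = 1`, `Λ` in
  place of `Λ♯`, version): its `q = 1` term alone is shift-uniform `k`-point Cesàro cancellation of
  `Λ♯` with arbitrary log-power savings — at `k = t`, `ν = (t-k)θ = 0`, exactly what
  `OpeningReduction` (iii) consumes for the full-opening term `A = [t]` — and it carries the whole
  PARITY content and the whole LANDAU–SIEGEL sensitivity of the crux (why it might fail: for `k ≥ 3`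
  only log/loglog-averaged sign-pattern cancellation is known, TaoTeravainenDuke2019; shift-uniform
  log-power savings fail in a Siegel-zero world, MatomakiMerikoski2023 Thm 1.3, exactly as for
  `DimOne`). Why plausibly true: it is implied by the crux (take any `0 < ν < 1/2 - θ`; the summand
  is `≥ 0` and `(log N)^B ≤ N^ν` eventually), and on tame classes the first-order main term of every
  opened factor vanishes (`∑_{d ∣ g} μ(d) = 0` for `1 < g ≤ N^{θ/2} ≤ N^θ`; refuter REVIEW.md on
  stmt-Parity-15172). Sources: SawinShusterman2018 (Thm 4.5, the 𝔽_q[T] theorem of this species),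
  TaoTeravainenDuke2019, MatomakiMerikoski2023, GoldstonYildirim2001.
* `stub_largeSieveRange` (S2 — the LARGE-SIEVE RANGE, conjecture-grade): for every admissible
  `(k, L, θ, ν, A, C)` there is an exponent `B = B(k, L, θ, ν, A, C)` such that the moduli
  `(log N)^B < q ≤ N^ν` contribute `≤ N (log N)^{-A}`. This is the `k`-point analogue of the
  large-sieve half of Bombieri–Vinogradov (`B = B(A)` there: Vaughan's identity + the multiplicative
  large sieve dispose of every modulus/conductor beyond `(log N)^B`); it is where a `k`-LINEAR
  dispersion / large-sieve engine for products `∏_{i<k} Λ♯(ψ_i(n))` along `n` is missing (why it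
  might fail: no such engine exists for `k ≥ 2` factors — the bilinear structure `Λ♯ = μ_{>P} ⋆ log`
  lives in each factor separately, not in `n`; a residual tame-class bias at some `ν₀ > 0` would
  refute it as FORM, cf. the route's kill criteria). Why plausibly true: implied by the crux for
  every `B` (sub-sum of non-negative terms); zero main term on tame classes; the 𝔽_q[T] model has
  level of distribution of `μ` in progressions beyond `1/2` (SawinShusterman2018 Thm 1.5-type).
  Sources: BombieriFriedlanderIwaniecActa1986, SawinShusterman2018, Polymath8b2014, IwaniecKowalski2004 (Thm 17.1).

**Composition (`HigherCores_of`, kernel-checked, no `sorry` of its own).** Given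
`(k, L, θ, ν, A, C)`: take `B, N₁` from S2 at `A + 1`, then `N₂` from S1 at `(A + 1, B)`, and
`N₀ = max (max N₁ N₂) ⌈e²⌉`. For `N ≥ N₀` the summand is `≥ 0`, so
`∑_{q ≤ N^ν} ≤ ∑_{q ≤ (log N)^B} + ∑_{(log N)^B < q ≤ N^ν} ≤ 2N(log N)^{-A-1} ≤ N(log N)^{-A}`
because `log N ≥ 2`. Neither stub alone gives the crux: S1 has no level, S2 has no small moduli
(and at `ν = 0` its range is empty).

**Hardest stub:** `stub_siegelWalfiszRange` (contains level-zero `k`-point Chowla-type cancellation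
for `Λ♯` with arbitrary log savings, shift-uniform: Hardy–Littlewood-complete for the `k`-tuple at
`k = t` by the route's own `OpeningReduction`, and Landau–Siegel-sensitive).

**Barriers** (route technique_class: determinant-equation dilated-chowla bombieri-vinogradov).
`Literature.Barriers.Parity.SelbergParityBarrier` / `PrimePairParity`: paid, not evaded — both stubs
are SIGNED Möbius statements (the parity content sits in S1), no sieve deduction is made here.
`LargeSieveLevelHalf`: respected — `ν + θ < 1/2` throughout; S2 asks for Möbius cancellation below
level `1/2`, never for primes in progressions beyond it. `FordFixedLevelBarrier`: not engaged (no
asymptotic is deduced from a fixed level). `LogarithmicAveraging`: the known log-averaged `k`-point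
results do not transfer to S1's Cesàro/log-power form — recorded as S1's failure mode, not claimed.

**Disproof used:** none exists for this crux (`ledger crux ls stmt-Parity-15172`: no workfiles, no
`Disproof.lean`, 2026-08-17). **Negatives index** (`ledger negatives --problem Parity`, 3 entries:
ConvMomentLevelOne 9541, TupleElliott 14832, RectangleChowla 4218): no stub instantiates one — both
stubs keep the crux's quantifier order (`N₀` after `A, B, C`; TupleElliott died of `A₀` before `N`)
and its tameness indicator (the rev-1 CRT witness of refuter-rattack-stmt-Parity-14637 is non-tame).
**Dead lines:** none recorded for this crux.

**Cheapest falsifier.** S2 at `k = 3`, `Ψ = (n, n+2, n+6)`, `θ = 0.1`, `ν = 0.39`: the refuter's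
`cores_bias.py` (attached to stmt-Parity-14637) restricted to TAME moduli `q ∈ ((log N)^B, N^ν]`
must show `∑_q |S_q| / N → 0`; a tame family with `∑_q |S_q| ≫ N` kills S2 (and the crux's FORM).
S1: the `q = 1`, `k = 3` Cesàro sum `∑_{n ≤ N} Λ♯(n)Λ♯(n+2)Λ♯(n+6)` at `θ = 0.45` must be `o(N)`
(numerics only indicative: the decomposition is pre-asymptotic at accessible `N`, REVIEW.md).

**BC3 audit (this seat, 2026-08-17; full record in `Lines/birth.md`):** `lean check --json` rc 0,
errors [], sorries 2 = the two `stub_*` declarations, zero elsewhere; `#print axioms HigherCores_of`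
= [propext, Classical.choice, Quot.sound]; `#h21_check_skeleton` ok (HigherCores_of concludes the crux
BY NAME). Probes (self-contained files in the seat's `bc/`, route file only, `maxHeartbeats 400000`):
`S1 → HigherCores`, `S1 → GeneralizedHardyLittlewood`, `S2 → HigherCores`,
`S2 → GeneralizedHardyLittlewood` by `first | exact? | simpa | aesop` all FAIL (rc 1: unsolved goals /
aesop exhaustive search failed; the combined `S1 → HigherCores` run ends in a whnf heartbeat timeout,
and its single-tactic runs give `exact?` "could not close the goal" at 4·10⁶ heartbeats — or at 4·10⁵
with the crux locally irreducible —, `simpa` "assumption failed", `aesop` "failed after exhaustive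
search"); 12/12 single-tactic runs fail. No landed theorem concludes `HigherCores` (`lean search`).

Layout (A12 skeleton-audit shape): §1 the two stub STATEMENTS as reducible `Prop`s
`Statement.stub_<name>` (obligation nodes BY NAME = the admissible hypotheses of `HigherCores_of`);
§2 the two sorried stubs `stub_<name>` with their signatures WRITTEN OUT; §3 two sorry-free
bookkeeping lemmas, `HigherCores_of : Statement.stub_siegelWalfiszRange →
Statement.stub_largeSieveRange → HigherCores`, an `example` re-checking the literal written-out form,
and `HigherCores_of_stubs : HigherCores`.
-/

namespace Summit.Parity.GeneralizedHardyLittlewood.Cruxes.HigherCores.Birth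

open scoped BigOperators Topology Manifold Classical MeasureTheory ProbabilityTheory Matrix InnerProductSpace ComplexConjugate ContinuousMap
open Filter Set Function TopologicalSpace MeasureTheory
open Summit.Parity.GeneralizedHardyLittlewood.Theses.DeterminantMoebiusCores

/-! ### §1 The two stub statements, by name -/

namespace Statement

/-- Statement of stub S1 `stub_siegelWalfiszRange` — `k`-POINT `Λ♯`-CORES TO POLYLOGARITHMIC MODULI
(the Siegel–Walfisz range): the crux's weighted tame sum with the level `N^ν` replaced by `(log N)^B`,
for every `B`; no `ν`. Reducible, so `HigherCores_of` sees through it.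
[cite: SawinShusterman2018, Thm 4.5; TaoTeravainenDuke2019; MatomakiMerikoski2023, Thm 1.3] -/
abbrev stub_siegelWalfiszRange : Prop :=
  ∀ (k L : ℕ) (θ A B C : ℝ), 3 ≤ k → 0 < θ → θ < 1 / 2 → 0 < A → 0 ≤ C → ∃ N₀ : ℕ, ∀ N : ℕ, N₀ ≤ N → ∀ Ψ : Fin k → Literature.NumberTheory.Sieve.AffLinForm 1, Literature.NumberTheory.Sieve.IsNondegenerateSystem Ψ → Literature.NumberTheory.Sieve.affLinSize Ψ N ≤ L → ∀ (r u v : ℕ → ℤ), (∀ q : ℕ, -(N : ℤ) ≤ u q ∧ v q ≤ N) → ∑ q ∈ Finset.Icc 1 ⌊Real.log N ^ B⌋₊, ((Nat.divisors q).card : ℝ) ^ C * (if ∀ i : Fin k, ((Int.gcd ((Ψ i).eval (fun _ => r q)) q : ℕ) : ℝ) ≤ (N : ℝ) ^ (θ / 2) then |∑ n ∈ (Finset.Icc (u q) (v q)).filter (fun n : ℤ => (q : ℤ) ∣ n - r q), ∏ i : Fin k, (∑ d ∈ Nat.divisors ((Ψ i).eval (fun _ => n)).toNat, if (N : ℝ)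 ^ θ < (d : ℝ) then (ArithmeticFunction.moebius d : ℝ) * Real.log (((((Ψ i).eval (fun _ => n)).toNat : ℕ) : ℝ) / (d : ℝ)) else 0)| else 0) ≤ (N : ℝ) / Real.log N ^ A

/-- Statement of stub S2 `stub_largeSieveRange` — `k`-POINT `Λ♯`-CORES ON THE LARGE-SIEVE RANGE:
for every admissible `(k, L, θ, ν, A, C)` some exponent `B` such that the moduli
`(log N)^B < q ≤ N^ν` of the crux's weighted tame sum contribute `≤ N (log N)^{-A}`. Reducible.
[cite: BombieriFriedlanderIwaniecActa1986; IwaniecKowalski2004, Thm 17.1; SawinShusterman2018] -/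
abbrev stub_largeSieveRange : Prop :=
  ∀ (k L : ℕ) (θ ν A C : ℝ), 3 ≤ k → 0 < θ → 0 ≤ ν → ν + θ < 1 / 2 → 0 < A → 0 ≤ C → ∃ B : ℝ, ∃ N₀ : ℕ, ∀ N : ℕ, N₀ ≤ N → ∀ Ψ : Fin k → Literature.NumberTheory.Sieve.AffLinForm 1, Literature.NumberTheory.Sieve.IsNondegenerateSystem Ψ → Literature.NumberTheory.Sieve.affLinSize Ψ N ≤ L → ∀ (r u v : ℕ → ℤ), (∀ q : ℕ, -(N : ℤ) ≤ u q ∧ v q ≤ N) → ∑ q ∈ Finset.Icc (⌊Real.log N ^ B⌋₊ + 1) ⌊(N : ℝ) ^ ν⌋₊, ((Nat.divisors q).card : ℝ) ^ C * (if ∀ i : Fin k, ((Int.gcd ((Ψ i).eval (fun _ => r q)) q : ℕ) : ℝ) ≤ (N : ℝ) ^ (θ / 2) then |∑ n ∈ (Finset.Icc (u q) (v q)).filter (fun n : ℤ => (q : ℤ) ∣ n - r q), ∏ i : Fin k, (∑ d ∈ Nat.divisors ((Ψ i).eval (fun _ => n)).toNat, if (N : ℝ) ^ θ < (d : ℝ)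 then (ArithmeticFunction.moebius d : ℝ) * Real.log (((((Ψ i).eval (fun _ => n)).toNat : ℕ) : ℝ) / (d : ℝ)) else 0)| else 0) ≤ (N : ℝ) / Real.log N ^ A

end Statement

/-! ### §2 The two stubs (the only `sorry`s of the file) -/

/-- **Stub S1 (Siegel–Walfisz range; conjecture-grade, the HARDEST).** `k`-point `Λ♯`-cores on tame
classes to every polylogarithmic level `(log N)^B`, with `(log N)^{-A}` savings for every `A`,
uniformly over non-degenerate `k`-systems of size `≤ L` (`k ≥ 3`, `0 < θ < 1/2`), all residues `r_q`
and all integer intervals `[u_q, v_q] ⊆ [-N, N]`; `Λ♯(m) = ∑_{d ∣ m, d > N^θ} μ(d) log(m/d)` inlined,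
tameness = whole shared part `gcd(ψ_i(r_q), q) ≤ N^{θ/2}` for all `i` (the crux's indicator, verbatim).
Its `q = 1` term is level-zero `k`-point Chowla-type cancellation for `Λ♯`, shift-uniform — the parity
and Landau–Siegel content of the crux. Implied by the crux (any `0 < ν < 1/2 - θ`).
[cite: SawinShusterman2018, Thm 4.5; TaoTeravainenDuke2019; MatomakiMerikoski2023, Thm 1.3; GoldstonYildirim2001] -/
theorem stub_siegelWalfiszRange :
    ∀ (k L : ℕ) (θ A B C : ℝ), 3 ≤ k → 0 < θ → θ < 1 / 2 → 0 < A → 0 ≤ C → ∃ N₀ : ℕ, ∀ N : ℕ, N₀ ≤ N → ∀ Ψ : Fin k → Literature.NumberTheory.Sieve.AffLinForm 1, Literature.NumberTheory.Sieve.IsNondegenerateSystem Ψ → Literature.NumberTheory.Sieve.affLinSize Ψ N ≤ L → ∀ (r u v : ℕ → ℤ), (∀ q : ℕ, -(N : ℤ) ≤ u q ∧ v q ≤ N) → ∑ q ∈ Finset.Icc 1 ⌊Real.log N ^ B⌋₊, ((Nat.divisors q).card : ℝ) ^ C * (if ∀ i : Fin k, ((Int.gcd ((Ψ i).eval (fun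 _ => r q)) q : ℕ) : ℝ) ≤ (N : ℝ) ^ (θ / 2) then |∑ n ∈ (Finset.Icc (u q) (v q)).filter (fun n : ℤ => (q : ℤ) ∣ n - r q), ∏ i : Fin k, (∑ d ∈ Nat.divisors ((Ψ i).eval (fun _ => n)).toNat, if (N : ℝ) ^ θ < (d : ℝ) then (ArithmeticFunction.moebius d : ℝ) * Real.log (((((Ψ i).eval (fun _ => n)).toNat : ℕ) : ℝ) / (d : ℝ)) else 0)| else 0) ≤ (N : ℝ) / Real.log N ^ A := by
  sorry

/-- **Stub S2 (large-sieve range; conjecture-grade).** For every admissible `(k, L, θ, ν, A, C)`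
(`k ≥ 3`, `θ > 0`, `ν ≥ 0`, `ν + θ < 1/2`) there is `B` such that, for `N ≥ N₀`, the moduli
`(log N)^B < q ≤ N^ν` of the crux's divisor-weighted tame sum contribute `≤ N (log N)^{-A}` — the
`k`-point analogue of the large-sieve half of Bombieri–Vinogradov (`B = B(A)` there), i.e. the
statement a `k`-linear dispersion / large-sieve engine along `n` would prove. Implied by the crux
(every `B`). [cite: BombieriFriedlanderIwaniecActa1986; IwaniecKowalski2004, Thm 17.1; SawinShusterman2018; Polymath8b2014] -/
theorem stub_largeSieveRange :
    ∀ (k L : ℕ) (θ ν A C : ℝ), 3 ≤ k → 0 < θ → 0 ≤ ν → ν + θ < 1 / 2 → 0 < A → 0 ≤ C → ∃ B : ℝ, ∃ N₀ : ℕ, ∀ N : ℕ, N₀ ≤ N → ∀ Ψ : Fin k → Literature.NumberTheory.Sieve.AffLinForm 1, Literature.NumberTheory.Sieve.IsNondegenerateSystem Ψ → Literature.NumberTheory.Sieve.affLinSize Ψ N ≤ L → ∀ (r u v : ℕ → ℤ), (∀ q : ℕ, -(N : ℤ) ≤ u q ∧ v q ≤ N) → ∑ q ∈ Finset.Icc (⌊Real.log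 N ^ B⌋₊ + 1) ⌊(N : ℝ) ^ ν⌋₊, ((Nat.divisors q).card : ℝ) ^ C * (if ∀ i : Fin k, ((Int.gcd ((Ψ i).eval (fun _ => r q)) q : ℕ) : ℝ) ≤ (N : ℝ) ^ (θ / 2) then |∑ n ∈ (Finset.Icc (u q) (v q)).filter (fun n : ℤ => (q : ℤ) ∣ n - r q), ∏ i : Fin k, (∑ d ∈ Nat.divisors ((Ψ i).eval (fun _ => n)).toNat, if (N : ℝ) ^ θ < (d : ℝ) then (ArithmeticFunction.moebius d : ℝ) * Real.log (((((Ψ i).eval (fun _ => n)).toNat : ℕ) : ℝ) / (d : ℝ)) else 0)| else 0) ≤ (N : ℝ) / Real.log N ^ A := by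
  sorry

/-! ### §3 The composition (real proofs) -/

/-- Splitting a sum of non-negative reals over `[1, M]` at `Q`: the two ranges `[1, Q]` and
`[Q + 1, M]` cover `[1, M]` (whatever the order of `Q` and `M`). [folklore] -/
theorem sum_Icc_le_sum_add_sum (f : ℕ → ℝ) (hf : ∀ q, 0 ≤ f q) (Q M : ℕ) :
    ∑ q ∈ Finset.Icc 1 M, f q ≤ ∑ q ∈ Finset.Icc 1 Q, f q + ∑ q ∈ Finset.Icc (Q + 1) M, f q := by
  have hsub : Finset.Icc 1 M ⊆ Finset.Icc 1 Q ∪ Finset.Icc (Q + 1) M := by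
    intro q hq
    simp only [Finset.mem_union, Finset.mem_Icc] at hq ⊢
    omega
  have hdisj : Disjoint (Finset.Icc 1 Q) (Finset.Icc (Q + 1) M) := by
    rw [Finset.disjoint_left]
    intro q hq hq'
    simp only [Finset.mem_Icc] at hq hq'
    omega
  calc ∑ q ∈ Finset.Icc 1 M, f q ≤ ∑ q ∈ Finset.Icc 1 Q ∪ Finset.Icc (Q + 1) M, f q :=
        Finset.sum_le_sum_of_subset_of_nonneg hsub (fun q _ _ => hf q)
    _ = ∑ q ∈ Finset.Icc 1 Q, f q + ∑ q ∈ Finset.Icc (Q + 1) M, f q := Finset.sum_union hdisj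

/-- Two savings of `(log N)^{-(A+1)}` add up to one saving of `(log N)^{-A}` once `log N ≥ 2`. [folklore] -/
theorem add_le_of_two_le_log {a b A : ℝ} {N : ℕ} (hlog : 2 ≤ Real.log N)
    (ha : a ≤ (N : ℝ) / Real.log N ^ (A + 1)) (hb : b ≤ (N : ℝ) / Real.log N ^ (A + 1)) :
    a + b ≤ (N : ℝ) / Real.log N ^ A := by
  have hlogpos : 0 < Real.log N := by linarith
  have hpow : 0 < Real.log N ^ A := Real.rpow_pos_of_pos hlogpos A
  have hX : 0 ≤ (N : ℝ) / Real.log N ^ A := div_nonneg (Nat.cast_nonneg N) hpow.le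
  have key : (N : ℝ) / Real.log N ^ (A + 1) = ((N : ℝ) / Real.log N ^ A) / Real.log N := by
    rw [Real.rpow_add hlogpos, Real.rpow_one, div_div]
  have h2 : 2 / Real.log N ≤ 1 := (div_le_one hlogpos).mpr hlog
  calc a + b ≤ (N : ℝ) / Real.log N ^ (A + 1) + (N : ℝ) / Real.log N ^ (A + 1) := add_le_add ha hb
    _ = ((N : ℝ) / Real.log N ^ A) * (2 / Real.log N) := by rw [key]; ring
    _ ≤ ((N : ℝ) / Real.log N ^ A) * 1 := mul_le_mul_of_nonneg_left h2 hX
    _ = (N : ℝ) / Real.log N ^ A := mul_one _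

/-- **BC3 composition.** `stub_siegelWalfiszRange → stub_largeSieveRange → HigherCores`, the
conclusion being literally the route decl `DeterminantMoebiusCores.HigherCores`, the hypotheses the
two stub statements BY NAME. Bombieri–Vinogradov bookkeeping: `B, N₁` from S2 at `A + 1`, `N₂` from S1
at `(A + 1, B)`, `N₀ = max (max N₁ N₂) ⌈e²⌉`; split the `q`-sum at `(log N)^B` (summand `≥ 0`) and add.
A complete proof term (no `sorry` here). [folklore] -/
theorem HigherCores_of :
    Statement.stub_siegelWalfiszRange → Statement.stub_largeSieveRange → HigherCores := by
  intro hS hL k L θ ν A C hk hθ hν hνθ hA hC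
  obtain ⟨B, N₁, hN₁⟩ := hL k L θ ν (A + 1) C hk hθ hν hνθ (by linarith) hC
  obtain ⟨N₂, hN₂⟩ := hS k L θ (A + 1) B C hk hθ (by linarith) (by linarith) hC
  refine ⟨max (max N₁ N₂) ⌈Real.exp 2⌉₊, fun N hN Ψ hΨ hsz r u v huv => ?_⟩
  have hN1 : N₁ ≤ N := le_trans (le_trans (le_max_left _ _) (le_max_left _ _)) hN
  have hN2 : N₂ ≤ N := le_trans (le_trans (le_max_right _ _) (le_max_left _ _)) hN
  have hNe : ⌈Real.exp 2⌉₊ ≤ N := le_trans (le_max_right _ _) hN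
  have hlog : (2 : ℝ) ≤ Real.log N := by
    have hexp : Real.exp 2 ≤ (N : ℝ) := le_trans (Nat.le_ceil _) (by exact_mod_cast hNe)
    have h := Real.log_le_log (Real.exp_pos 2) hexp
    rwa [Real.log_exp] at h
  have h1 := hN₂ N hN2 Ψ hΨ hsz r u v huv
  have h2 := hN₁ N hN1 Ψ hΨ hsz r u v huv
  refine le_trans (sum_Icc_le_sum_add_sum _ (fun q => ?_) _ _) (add_le_of_two_le_log hlog h1 h2)
  refine mul_nonneg (Real.rpow_nonneg (Nat.cast_nonneg _) C) ?_
  split_ifs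
  · exact abs_nonneg _
  · exact le_rfl

/-- The hypothetical form of the composition with the two stub signatures WRITTEN OUT (an `example`,
so that `HigherCores_of` / `HigherCores_of_stubs` stay the declarations concluding the crux). -/
example :
    (∀ (k L : ℕ) (θ A B C : ℝ), 3 ≤ k → 0 < θ → θ < 1 / 2 → 0 < A → 0 ≤ C → ∃ N₀ : ℕ, ∀ N : ℕ, N₀ ≤ N → ∀ Ψ : Fin k → Literature.NumberTheory.Sieve.AffLinForm 1, Literature.NumberTheory.Sieve.IsNondegenerateSystem Ψ → Literature.NumberTheory.Sieve.affLinSize Ψ N ≤ L → ∀ (r u v : ℕ → ℤ), (∀ q : ℕ, -(N : ℤ) ≤ u q ∧ v q ≤ N) → ∑ q ∈ Finset.Icc 1 ⌊Real.log N ^ B⌋₊, ((Nat.divisors q).card : ℝ) ^ C * (if ∀ i : Fin k, ((Int.gcd ((Ψ i).eval (fun _ => r q)) q : ℕ) : ℝ) ≤ (N : ℝ) ^ (θ / 2) then |∑ n ∈ (Finset.Icc (u q) (v q)).filter (fun n : ℤ => (q : ℤ) ∣ n - r q), ∏ i : Fin k, (∑ d ∈ Nat.divisors ((Ψ i).eval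 (fun _ => n)).toNat, if (N : ℝ) ^ θ < (d : ℝ) then (ArithmeticFunction.moebius d : ℝ) * Real.log (((((Ψ i).eval (fun _ => n)).toNat : ℕ) : ℝ) / (d : ℝ)) else 0)| else 0) ≤ (N : ℝ) / Real.log N ^ A) →
    (∀ (k L : ℕ) (θ ν A C : ℝ), 3 ≤ k → 0 < θ → 0 ≤ ν → ν + θ < 1 / 2 → 0 < A → 0 ≤ C → ∃ B : ℝ, ∃ N₀ : ℕ, ∀ N : ℕ, N₀ ≤ N → ∀ Ψ : Fin k → Literature.NumberTheory.Sieve.AffLinForm 1, Literature.NumberTheory.Sieve.IsNondegenerateSystem Ψ → Literature.NumberTheory.Sieve.affLinSize Ψ N ≤ L → ∀ (r u v : ℕ → ℤ), (∀ q : ℕ, -(N : ℤ) ≤ u q ∧ v q ≤ N) → ∑ q ∈ Finset.Icc (⌊Real.log N ^ B⌋₊ + 1) ⌊(N : ℝ) ^ ν⌋₊, ((Nat.divisors q).card : ℝ) ^ C * (if ∀ i : Fin k, ((Int.gcd ((Ψ i).eval (fun _ => r q)) q : ℕ) : ℝ) ≤ (N : ℝ) ^ (θ / 2) then |∑ n ∈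 (Finset.Icc (u q) (v q)).filter (fun n : ℤ => (q : ℤ) ∣ n - r q), ∏ i : Fin k, (∑ d ∈ Nat.divisors ((Ψ i).eval (fun _ => n)).toNat, if (N : ℝ) ^ θ < (d : ℝ) then (ArithmeticFunction.moebius d : ℝ) * Real.log (((((Ψ i).eval (fun _ => n)).toNat : ℕ) : ℝ) / (d : ℝ)) else 0)| else 0) ≤ (N : ℝ) / Real.log N ^ A) →
    Summit.Parity.GeneralizedHardyLittlewood.Theses.DeterminantMoebiusCores.HigherCores :=
  HigherCores_of

/-- The crux, closed modulo the two stubs (`sorry` enters only through `stub_*`). -/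
theorem HigherCores_of_stubs :
    Summit.Parity.GeneralizedHardyLittlewood.Theses.DeterminantMoebiusCores.HigherCores :=
  HigherCores_of stub_siegelWalfiszRange stub_largeSieveRange

-- audit: the conclusion is the route decl itself
#check (HigherCores_of_stubs : Summit.Parity.GeneralizedHardyLittlewood.Theses.DeterminantMoebiusCores.HigherCores)

end Summit.Parity.GeneralizedHardyLittlewood.Cruxes.HigherCores.Birth
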